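import Summits.QuantumFields.BalabanUV.Beta.EriceFlowEnclosureDerivClause
import Summits.QuantumFields.BalabanUV.Beta.EriceFlowEnclosureLowerAtZeroPrinted
import Literature.MathematicalPhysics.QuantumFieldTheory.Balaban1983to89.T4ContinuumYM4Torus

/-!
# Beta / EriceFlowEnclosureDerivClausePrinted — [I] THEOREM 2 AS PRINTED and the T⁴ headline's β-binder FROM THE TYPED RECORDS
# + [I] p. 264's clause BY NAME + the signs of the one-loop coefficients (β-flow team, prover 1, unit `b2b-balaban-beta-bflow-p1`,
# gen 3; coordinator ruling e34b3e0c item (1) «redirect towards the summit»)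

HONEST FRAMING (page 1 of everything the β sub-cell writes): discharging `BetaPertH` makes Bałaban's UV stability
UNCONDITIONAL — a real constructive-QFT result; it is NOT the continuum limit and NOT the Clay problem.  HONEST DEPENDENCY
(cell reorg 2026-08-19, verbatim): «continuum YM on T⁴ ⇐ BetaPertH ∧ nine spine estimates (0/9 proved); BetaPertH ⇐ (D1) ∧
(D4) ∧ CAP+tail; G-an2-4 gates asym, D1 and NE2/3/4.»  THIS MODULE DISCHARGES NOTHING OF BAŁABAN'S: two compositions BY NAME —
the sibling `EriceFlowEnclosureDerivClause` (gen 3: sign at zero, √s-modulus and «regular» from the records + the typed clause),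
prover 2's `EriceFlowEnclosureLowerAtZeroPrinted.thm2Printed_of_signsAtZero'` (p251662) and the tree's print-faithful headline
`T4ContinuumYM4Torus.continuumYM4_torus_of_endpointExistence`.  ABSOLUTE RULE respected: every Erice ∕ [I] sentence is a
HYPOTHESIS by typed name (`UnifBoundedConvergent369`, `NegativeNearZero369`, `BetaDerivClause.LastVarLipschitz` — the last with
its UNPRINTED k-uniformity, row an4's located hypothesis, GAPS G-b12-2 ∕ G-adv2-3 (b)); (B) and the nine-estimate spine slot are
hypotheses; the Markov reading (`ForwardGenerated C (ofErice βE)`) is gap (G4) — NOT asserted of Bałaban's construction.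

WHAT THIS FILE ADDS (gen 3, #11).
§1 **`thm2Printed_of_records_lastVarLipschitz_allSigns`** — [I] THEOREM 2 VERBATIM (`B12.Thm2Printed C L`, (0.31) at every
   `k ≤ K`, every `L > 1`) for every construction forward-generated by the dictionary family, from: `LastVarLipschitz (ofErice βE) C γ`,
   `UnifBoundedConvergent369 βE β S` (POINTWISE; used at 0 and for the bound), `NegativeNearZero369 β`, `[0, γ²] ⊆ S`, and THE SIGNS
   OF THE ONE-LOOP COEFFICIENTS `β_n(0) < 0` FOR EVERY n (Erice orientation; = `β⁰_{n+1} > 0`, `beta0_split_ofErice` — the SIGN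
   content of (D1) ∧ CAP+tail, no value, no rate).  Compare prover 1's gen-1 `thm2Printed_of_BJ86_of_list` (needed `Sandwich369`,
   `Regular361` and the full small-n list `β_n(s) ≤ β′` on ]0,δ]): the clause + signs at zero replace all three.
§2 **`continuumYM4_torus_of_records_lastVarLipschitz`** (+ `_nonvacuous`) — the T⁴ headline `ContinuumYM4Torus D` for a
   printed-averaged SU(N) datum with (B), spine slot `HybridNE7Under`, coupling flow forward-generated by `ofErice βE`, and the
   β-binder `hEnd` discharged from {`LastVarLipschitz`, `UnifBoundedConvergent369`, `NegativeNearZero369`, `[0, γ²] ⊆ S`} (the sibling's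
   `endpointExistence_of_records_lastVarLipschitz`) — prover 1's gen-1 `EriceFlowEnclosureT4.continuumYM4_torus_of_BJ86` with
   (3.69) `Sandwich369` and (3.61) `Regular361` REPLACED by [I]'s typed clause.  Reading of the dependency line made kernel-explicit:
   «continuum YM on T⁴ ⇐ [Erice p. 249 sentence (pointwise, at 0) ∧ [I] p. 264 clause (k-uniform, UNPRINTED as such), for
   Erice-Markov data] ∧ (B) ∧ nine spine estimates (0/9)».

CITATION-FIT LINES (recorded, not adjudicated).  P-FIT-1: §1's sign input is `∀ n, β_n(0) < 0` — ALL scales (tail AND list),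
numbers at g = 0 only; this is STRONGER than (3.69)'s «n sufficiently large» on the list part and equal to what P2's Z-FIT-5 prices
(«one SIGN per early scale»); the tail part is already implied by the records (`signAtZero_of_records`), so the binder is
redundant from `n₀` on and load-bearing below it (= CAP list, G-2 ∕ E-FIT-2).  P-FIT-2: D-FIT-1…3 of the sibling unchanged (first
order in g through `ofErice`, ONE constant all scales; closed interval; Markov).  Imports `EriceFlowEnclosureDerivClause`,
`EriceFlowEnclosureLowerAtZeroPrinted`, `T4ContinuumYM4Torus`; 0 `def`, 0 `sorry`.  NOT `BetaPertH`, NOT continuum, NOT Clay.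
-/

namespace Summit.QuantumFields.BalabanUV.Beta.EriceFlowEnclosureDerivClausePrinted

open Filter Set
open scoped Topology
open Literature.MathematicalPhysics.QuantumFieldTheory.Balaban1983to89
open Literature.MathematicalPhysics.QuantumFieldTheory.Balaban1983to89.FlowStep
open Literature.MathematicalPhysics.QuantumFieldTheory.Balaban1983to89.FlowStepRuns
open Literature.MathematicalPhysics.QuantumFieldTheory.Balaban1983to89.DagBinding
open Literature.MathematicalPhysics.QuantumFieldTheory.Balaban1983to89.T4Continuum
open Literature.MathematicalPhysics.QuantumFieldTheory.Balaban1983to89.T4ContinuumYM4Torus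
open Literature.MathematicalPhysics.QuantumFieldTheory.BalabanJaffe1986.BJ86CouplingRenormalization
open Summit.QuantumFields.BalabanUV.Beta.EriceFlowEnclosure
open Summit.QuantumFields.BalabanUV.Beta.EriceFlowEnclosureDerivClause

noncomputable section

/-! ## §1 [I] Theorem 2 as printed from the records, the typed clause and the signs of the one-loop coefficients -/

/-- **[I] THEOREM 2 AS PRINTED, from typed records + [I] p. 264's clause by name + signs at zero.**  `LastVarLipschitz (ofErice βE) C γ`
+ «uniformly bounded and convergent» on `S ⊇ [0, γ²]` + «negative in a sufficiently small neighborhood of zero» + `β_n(0) < 0` for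
every `n` ⟹ `B12.Thm2Printed C L` for every construction forward-generated by `ofErice βE` and every `L > 1`.  Road: the sibling
supplies the tail sign (`signAtZero_of_records`, c = −β(0)/2), the √s-modulus (`hoelderAtZero_of_lastVarLipschitz`) and «regular»
(`regular361_of_lastVarLipschitz`); prover 2's `thm2Printed_of_signsAtZero'` assembles (0.31) at every scale with the list signs.
[cite: Balaban1987RG1, Thm 2 p.259 and §1 p.264 (β-clause)] -/
theorem thm2Printed_of_records_lastVarLipschitz_allSigns {βE : ℕ → ℝ → ℝ} {βlim : ℝ → ℝ} {S : Set ℝ} {C γ : ℝ}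
    (hγ : 0 < γ) (hS : Set.Icc 0 (γ ^ 2) ⊆ S) (hLip : BetaDerivClause.LastVarLipschitz (ofErice βE) C γ)
    (hbc : UnifBoundedConvergent369 βE βlim S) (hneg : NegativeNearZero369 βlim) (hsigns : ∀ n, βE n 0 < 0)
    {K : B12.Construction} (hgen : ForwardGenerated K (ofErice βE)) {L : ℝ} (hL : 1 < L) :
    B12.Thm2Printed K L := by
  have h0 : (0 : ℝ) ∈ S := hS ⟨le_rfl, by positivity⟩
  obtain ⟨hβ0, n₀, hsign⟩ := signAtZero_of_records hbc h0 hneg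
  obtain ⟨⟨M, hM⟩, -⟩ := hbc
  have hmod := hoelderAtZero_of_lastVarLipschitz hγ hLip
  have hmod' : ∀ n, n₀ ≤ n → ∀ s, 0 ≤ s → s ≤ γ ^ 2 → |βE n s - βE n 0| ≤ max C 0 * Real.sqrt s :=
    fun n _ s hs hsγ => (hmod n s hs hsγ).trans (mul_le_mul_of_nonneg_right (le_max_left _ _) (Real.sqrt_nonneg _))
  exact EriceFlowEnclosureLowerAtZeroPrinted.thm2Printed_of_signsAtZero' (c := -(βlim 0 / 2)) (by positivity)
    (by linarith) (fun n s hs => hM n s (hS hs)) (fun n hn => by have := hsign n hn; linarith)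
    (EriceFlowEnclosureLowerAtZero.uniformEquicontAtZero_of_hoelder (le_max_right _ _) hmod')
    (fun n _ => hsigns n) (regular361_of_lastVarLipschitz hγ hLip) hgen hL

/-! ## §2 The T⁴ headline with its β-binder from the records + the typed clause -/

section T4

variable {F : T4Family} {N : ℕ} [NeZero N]

/-- **The print-faithful T⁴ headline with the β-binder read against the typed records + [I]'s clause.**  For a printed-averaged
finite-ε datum `D` on `SU(N)` with (B) (`B16.EndStatementBPrinted D.C`), whose coupling flow is generated forward by Erice's (3.62)
through `ofErice βE` (Markov reading, gap (G4)), the typed sentences `UnifBoundedConvergent369 βE β S`, `NegativeNearZero369 β` on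
`S ⊇ [0, γ²]`, the typed clause `LastVarLipschitz (ofErice βE) C γ` and the spine slot `HybridNE7Under D (EndpointExistence D.C.toB12)`:
`ContinuumYM4Torus D` (= `continuumYM4_torus_of_endpointExistence` with `hEnd := endpointExistence_of_records_lastVarLipschitz …`).
Every binder is a hypothesis; (3.69) and (3.61) are no longer among them. [cite: Balaban1987RG1, Thm 2 p.259 and §1 p.264 (β-clause)] -/
theorem continuumYM4_torus_of_records_lastVarLipschitz (D : FiniteEpsData F (Matrix.specialUnitaryGroup (Fin N) ℂ))
    (hD : D.IsPrintedAveraged) (hB : B16.EndStatementBPrinted D.C)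
    (βE : ℕ → ℝ → ℝ) {βlim : ℝ → ℝ} {S : Set ℝ} {C γ : ℝ} (hγ : 0 < γ) (hS : Set.Icc 0 (γ ^ 2) ⊆ S)
    (hLip : BetaDerivClause.LastVarLipschitz (ofErice βE) C γ)
    (hbc : UnifBoundedConvergent369 βE βlim S) (hneg : NegativeNearZero369 βlim)
    (hgen : DagBinding.ForwardGenerated D.C.toB12 (ofErice βE))
    (hNE : T4ApexHybrid.HybridNE7Under D (DagBinding.EndpointExistence D.C.toB12)) : ContinuumYM4Torus D :=
  continuumYM4_torus_of_endpointExistence D hD hB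
    (endpointExistence_of_records_lastVarLipschitz hγ hS hLip hbc hneg hgen) hNE

/-- The same with its non-vacuity clause (tuned bare-coupling sequences exist), = the tree's
`continuumYM4_torus_of_endpointExistence_nonvacuous` with `hEnd` from the records + the clause.
[cite: Balaban1987RG1, Thm 2 p.259 and §1 p.264 (β-clause)] -/
theorem continuumYM4_torus_of_records_lastVarLipschitz_nonvacuous
    (D : FiniteEpsData F (Matrix.specialUnitaryGroup (Fin N) ℂ))
    (hD : D.IsPrintedAveraged) (hB : B16.EndStatementBPrinted D.C)
    (βE : ℕ → ℝ → ℝ) {βlim : ℝ → ℝ} {S : Set ℝ} {C γ : ℝ} (hγ : 0 < γ) (hS : Set.Icc 0 (γ ^ 2) ⊆ S)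
    (hLip : BetaDerivClause.LastVarLipschitz (ofErice βE) C γ)
    (hbc : UnifBoundedConvergent369 βE βlim S) (hneg : NegativeNearZero369 βlim)
    (hgen : DagBinding.ForwardGenerated D.C.toB12 (ofErice βE))
    (hNE : T4ApexHybrid.HybridNE7Under D (DagBinding.EndpointExistence D.C.toB12)) :
    ContinuumYM4Torus D ∧ ContinuumYM4TorusE D :=
  continuumYM4_torus_of_endpointExistence_nonvacuous D hD hB
    (endpointExistence_of_records_lastVarLipschitz hγ hS hLip hbc hneg hgen) hNE

end T4

end

end Summit.QuantumFields.BalabanUV.Beta.EriceFlowEnclosureDerivClausePrinted
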